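import Mathlib
import HarnessLib
import Summits.NavierStokesRegularity.NavierStokesRegularity.Theorems.ChiralWindowDoorDefs
import Summits.NavierStokesRegularity.NavierStokesRegularity.Theorems.ChiralWindowDoorLocalHelicityLower
import Summits.NavierStokesRegularity.NavierStokesRegularity.Theorems.ChiralWindowDoorClassDerivDecay
import Summits.NavierStokesRegularity.NavierStokesRegularity.Theorems.ChiralWindowDoorTimeIntegratedError
import Summits.NavierStokesRegularity.NavierStokesRegularity.Theorems.ChiralWindowDoorHelicityBudgetTools
import Summits.NavierStokesRegularity.NavierStokesRegularity.Theorems.ChiralWindowDoorHelicityBudgetIdentity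
import Summits.NavierStokesRegularity.NavierStokesRegularity.Theorems.ChiralWindowDoorHelicityFluxBounds

/-!
# Door S20 «ChiralWindowDoor» — stub B3 `stub_helicityBudget` PROVED: the localised helicity budget of a door-class
# profile with `O(1)` fluxes, `h(a_R, v(t₀)) + 2∫_{t<t₀} h(a_R, ω(t)) dt ≤ c` uniformly in `R > 0`, `t₀ < 0`

Door S20 of nsreg-p1's local Type-I door family (`HOME/ns-regularity-ideate-p1/r19/R19-LINE.md` §B3, line
`r19/Sketch20v5.lean` 7f13084196f4f031; DESIGN-ONLY, route NOT born).  Assembly of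

* the identity `d/dt h(a_R, v) = F_R(t) − 2 h(a_R, ω)` on `(−∞,0)` for the profile's classical pressure
  (`…HelicityBudgetIdentity.hasDerivAt_locHelicity_dissipation`, `…ClassDerivDecay.pressureDecay_of_class`);
* the flux bound `|F_R(t)| ≤ C_F R²/(R+√(−t))⁴` (`…HelicityFluxBounds.exists_helicityFlux_bound`) and
  `∫_{t<0} R²/(R+√(−t))⁴ ≤ 1` (`…TimeIntegratedError.integral_Iio_kernel_le`, `b = R`);
* `h(a_R, v(t)) → 0` as `t → −∞` and the integrability of `t ↦ h(a_R, ω(t))` on `(−∞,t₀)`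
  (`…HelicityBudgetTools.tendsto_locHelicity_atBot`, `integrableOn_locHelicity_curl`);

by the fundamental theorem of calculus on `(−∞, t₀]` (Mathlib `integral_Iic_of_hasDerivAt_of_tendsto`; the flux is
measurable in `t` because it equals `deriv h + 2 h(a_R, ω)` there):
`h(a_R, v(t₀)) + 2∫_{t<t₀} h(a_R, ω) = ∫_{t≤t₀} F_R ≤ C_F`.

* `helicityBudget` — **stub B3 of `r19/Sketch20v5.lean` (text verbatim over the tree substrate), PROVED.**

With B1′ (`…LocalHelicityLower`), B2′ (`…LocalDissipationLower`), B5b (`…EssLocalClass`) and B5a in class form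
(`…SobolevFatou`) this closes the residue line of K2: see `…ChiralWindowDoorProfileRigidityOfB3` (next file) for the
everywhere-form residue `HomochiralProfileRigidity` as an unconditional theorem.

Seat nsreg-p6 g12 (THEOREMS-ONLY door sequels, DIRECTOR-NS g8 #32 (2)/#36).  WHAT THIS IS NOT: not NS regularity
(Clay A); not K2 (the spread input and K1 remain); no route is opened.
-/

noncomputable section

-- the summit and its single sub-problem share the name (CONVENTIONS §1), as in every Theorems file
set_option linter.dupNamespace false

namespace Summit.NavierStokesRegularity.NavierStokesRegularity.Theorems.ChiralWindowDoorHelicityBudget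

open MeasureTheory Set Filter Topology Metric Function
open scoped RealInnerProductSpace
open Literature.Analysis Literature.Analysis.FluidPDE
open Summit.NavierStokesRegularity.NavierStokesRegularity.Theorems.ChiralWindowDoorDefs
open Summit.NavierStokesRegularity.NavierStokesRegularity.Theorems.ChiralWindowDoorLocalHelicityLower
  (contDiff_bumpSq hasCompactSupport_bumpSq)
open Summit.NavierStokesRegularity.NavierStokesRegularity.Theorems.ChiralWindowDoorClassDerivDecay (pressureDecay_of_class)
open Summit.NavierStokesRegularity.NavierStokesRegularity.Theorems.ChiralWindowDoorTimeIntegratedError (integral_Iio_kernel_le)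
open Summit.NavierStokesRegularity.NavierStokesRegularity.Theorems.ChiralWindowDoorHelicityBudgetTools
  (tendsto_locHelicity_atBot integrableOn_locHelicity_curl)
open Summit.NavierStokesRegularity.NavierStokesRegularity.Theorems.ChiralWindowDoorHelicityBudgetIdentity
  (hasDerivAt_locHelicity_dissipation)
open Summit.NavierStokesRegularity.NavierStokesRegularity.Theorems.ChiralWindowDoorHelicityFluxBounds
  (exists_helicityFlux_bound)

/-- **Stub B3 `stub_helicityBudget` of nsreg-p1 `r19/Sketch20v5.lean` (text verbatim over the tree substrate), PROVED —
THE LOCALISED HELICITY BUDGET WITH `O(1)` FLUXES.**  For a door-class profile and the weights `a_R = η(·/R)²` there is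
`c` (`= C_F`, independent of `R > 0` and `t₀ < 0`) with `h(a_R, v(t₀)) + 2∫_{t<t₀} h(a_R, curl v(t)) dt ≤ c`. -/
theorem helicityBudget : ∀ (η : EuclideanSpace ℝ (Fin 3) → ℝ), IsAdmissibleBump η → ∀ (C D K : ℝ)
    (v : ℝ → EuclideanSpace ℝ (Fin 3) → EuclideanSpace ℝ (Fin 3)),
    HasTypeITimeDecay C v → HasTypeIDecay D v → HasTypeIDerivDecay K v →
    ContinuousOn (Function.uncurry v) (Set.Iio (0 : ℝ) ×ˢ Set.univ) →
    (∀ s t : ℝ, s < t → t < 0 → ∀ x,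
        v t x = UnboundedOperators.heatExtension (v s) (t - s) x - oseenDuhamel 1 s v v t x) →
    (∀ t < 0, VectorCalculus.IsDivFree (v t)) →
    ∃ c : ℝ, ∀ R > (0 : ℝ), ∀ t₀ < (0 : ℝ),
      locHelicity (bumpSq η R) (v t₀) + 2 * ∫ t in Set.Iio t₀, locHelicity (bumpSq η R) (curl (v t)) ≤ c := by
  intro η hη C D K v hrate hdecay _hder hcont hmild hdiv
  -- a classical pressure with the scale-invariant package, and the flux constant
  obtain ⟨q, K', hsol, hK'⟩ := pressureDecay_of_class C D v hrate hdecay hcont hmild hdiv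
  obtain ⟨C_F, hCF, hflux⟩ := exists_helicityFlux_bound hη hdecay hsol hK'
  refine ⟨C_F, fun R hR t₀ ht₀ => ?_⟩
  -- the weight
  have ha1 : ContDiff ℝ 1 (bumpSq η R) := (contDiff_bumpSq hη R).of_le (by norm_cast)
  have hac : HasCompactSupport (bumpSq η R) := hasCompactSupport_bumpSq hη hR
  -- the three functions of time
  set h : ℝ → ℝ := fun s => locHelicity (bumpSq η R) (v s) with hh
  set d : ℝ → ℝ := fun s => locHelicity (bumpSq η R) (curl (v s)) with hd
  set F : ℝ → ℝ := fun s => (∫ x, ⟪v s x, curl (v s) x⟫ * fderiv ℝ (bumpSq η R) x (v s x)) +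
      (∫ x, (q s x - (1 / 2) * ‖v s x‖ ^ 2) * fderiv ℝ (bumpSq η R) x (curl (v s) x)) -
      (∫ x, ⟪curl (curl (v s)) x, curlCLM ((fderiv ℝ (bumpSq η R) x).smulRight (v s x))⟫) with hF
  set k : ℝ → ℝ := fun s => R ^ 2 * ((R + Real.sqrt (-s)) ^ 4)⁻¹ with hk
  show h t₀ + 2 * ∫ t in Iio t₀, d t ≤ C_F
  -- the identity on `(−∞,0)`
  have hderiv : ∀ s, s < 0 → HasDerivAt h (F s - 2 * d s) s := fun s hs =>
    hasDerivAt_locHelicity_dissipation hsol hs ha1 hac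
  -- the flux bound and the kernel
  have hFb : ∀ s, s < 0 → |F s| ≤ C_F * k s := fun s hs => hflux R hR s hs
  obtain ⟨hki, hkval⟩ := integral_Iio_kernel_le hR R
  have hknn : ∀ s, 0 ≤ k s := fun s => by rw [hk]; positivity
  have hsub : Iic t₀ ⊆ Iio (0 : ℝ) := fun s hs => lt_of_le_of_lt hs ht₀
  -- integrability of `d` on `Iic t₀` (from `Iio (t₀/2)`)
  have hdi0 : IntegrableOn d (Iio (t₀ / 2)) :=
    integrableOn_locHelicity_curl hη hrate hdecay hcont hmild hdiv hR (by linarith)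
  have hdi' : IntegrableOn d (Iic t₀) := hdi0.mono_set fun s hs => by
    have : s ≤ t₀ := hs
    show s < t₀ / 2
    linarith
  have hdi : IntegrableOn d (Iio t₀) := hdi'.mono_set Iio_subset_Iic_self
  -- measurability of `F` on `Iic t₀`: `F = deriv h + 2 d` there
  have hFm : AEStronglyMeasurable F (volume.restrict (Iic t₀)) := by
    have hm : AEStronglyMeasurable (fun s => deriv h s + 2 * d s) (volume.restrict (Iic t₀)) :=
      (measurable_deriv h).aestronglyMeasurable.add (hdi'.aestronglyMeasurable.const_mul 2)
    refine hm.congr ((ae_restrict_iff' measurableSet_Iic).2 (ae_of_all _ fun s hs => ?_))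
    show deriv h s + 2 * d s = F s
    rw [(hderiv s (hsub hs)).deriv]
    ring
  -- integrability of `F` on `Iic t₀`
  have hkiC : IntegrableOn (fun s => C_F * k s) (Iic t₀) := (hki.mono_set hsub).const_mul C_F
  have hFi : IntegrableOn F (Iic t₀) := by
    refine Integrable.mono' hkiC hFm ((ae_restrict_iff' measurableSet_Iic).2 (ae_of_all _ fun s hs => ?_))
    rw [Real.norm_eq_abs]
    exact hFb s (hsub hs)
  -- FTC on `(−∞, t₀]`
  have hcwa : ContinuousWithinAt h (Iic t₀) t₀ := (hderiv t₀ ht₀).continuousAt.continuousWithinAt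
  have htend : Tendsto h atBot (𝓝 0) := tendsto_locHelicity_atBot hη hrate hdecay hcont hmild hdiv hR
  have hFTC := integral_Iic_of_hasDerivAt_of_tendsto hcwa (fun s hs => hderiv s ((mem_Iio.1 hs).trans ht₀))
    (hFi.sub (hdi'.const_mul 2)) htend
  rw [sub_zero, integral_sub hFi (hdi'.const_mul 2), integral_const_mul, integral_Iic_eq_integral_Iio (f := d)] at hFTC
  -- `h t₀ + 2∫ d = ∫_{Iic t₀} F ≤ C_F ∫_{Iic t₀} k ≤ C_F ∫_{Iio 0} k ≤ C_F`
  have h1 : ∫ s in Iic t₀, F s ≤ ∫ s in Iic t₀, C_F * k s :=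
    setIntegral_mono_on hFi hkiC measurableSet_Iic fun s hs => (le_abs_self _).trans (hFb s (hsub hs))
  have h2 : ∫ s in Iic t₀, k s ≤ ∫ s in Iio (0 : ℝ), k s :=
    setIntegral_mono_set hki (ae_of_all _ hknn) (ae_of_all _ hsub)
  have h3 : ∫ s in Iio (0 : ℝ), k s ≤ 1 := hkval.trans (le_of_eq (by field_simp))
  calc h t₀ + 2 * ∫ t in Iio t₀, d t = ∫ s in Iic t₀, F s := by linarith
    _ ≤ ∫ s in Iic t₀, C_F * k s := h1
    _ = C_F * ∫ s in Iic t₀, k s := integral_const_mul _ _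
    _ ≤ C_F * 1 := mul_le_mul_of_nonneg_left (h2.trans h3) hCF
    _ = C_F := mul_one _

end Summit.NavierStokesRegularity.NavierStokesRegularity.Theorems.ChiralWindowDoorHelicityBudget

end
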